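import Literature.NumberTheory.LFunctions.ExceptionalCharacterTwinPrimes
import Literature.NumberTheory.LFunctions.KloostermanPrimePower
import Mathlib.NumberTheory.PrimeCounting
import HarnessLib

/-!
# Exceptional characters ⇒ cancellation in Kloosterman sums over primes, and sign changes at
# products of two primes (Drappeau–Maynard 2019)

Statement layer for the «illusory world» column (conditional consequences of exceptional
characters), NEW topic «Kloosterman sums / horizontal Sato–Tate». Source: S. Drappeau, J. Maynard,
*Sign changes of Kloosterman sums and exceptional characters*, Proc. Amer. Math. Soc. 147 (2019)
61–75 [DrappeauMaynard2018]; held copy = arXiv:1802.10278 (tex), §1: Theorem 1.1, Theorem 1.2,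
Corollary 1.3.

`Kl(a, n) = n^{−1/2} ∑_{ν mod n, (ν,n)=1} e((ν + aν̄)/n)` (normalised; `|Kl(1,p)| ≤ 2`); the horizontal
Sato–Tate conjecture predicts `∑_{p ≤ x} Kl(1, p) = o(π(x))`, of which «very little is known». With
`η_χ := L(1, χ) log D` for a real primitive `χ mod D` (the Friedlander–Iwaniec quantity: the tree's
`SmallEtaCharacters ε` says `η_χ ≤ ε` at arbitrarily large `D`), Theorem 1.1 is UNCONDITIONAL but
non-trivial only for small `η_χ`: `|∑_{p<x} Kl(1,p)| ≤ π(x)(ε + B L(1,χ) log x)` for `x ≥ D^A`; «if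
there is a sequence of characters with `η_{χ_i} → 0`, then … `∑_{p<x} Kl(1,p) = o(π(x))`» along a
sequence of `x`. Corollary 1.3: if `η_χ ≤ c` then every `[x, 2x] ⊂ [D^A, D^{100A}]` contains
`n₁, n₂` with `ω(n₁) = ω(n₂) = 2` and `Kl(1, n₁) Kl(1, n₂) < 0`.

* `DrappeauMaynard2019.kl n = Kl(1, n)` on the tree's `kloostermanSum` (`S(1,1;n)/√n`);
* `drappeauMaynard2019_theorem11` — NAMED FACT, Theorem 1.1 AS PRINTED (`x` natural, `∑_{p<x}`
  over `Nat.primesBelow x`, `π(x) = Nat.primeCounting x`, `L(1,χ)` as `‖L(1,χ)‖`);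
* `drappeauMaynard2019_corollary13` — NAMED FACT, Corollary 1.3 AS PRINTED (`Kl(1,n)` real: the
  product of real parts is `< 0`; `x` natural with `D^A ≤ x`, `2x ≤ D^{100A}`);
* PROVED readings on the column's family: `DrappeauMaynard2019.horizontalSatoTate_frequently`
  — `(∀ ε > 0, SmallEtaCharacters ε)` (= «a sequence with `η_{χ_i} → 0`», the hypothesis of
  Heath-Brown's / Friedlander–Iwaniec's twin-prime theorem) ⇒ for every `ε > 0` there are
  arbitrarily large `x` with `|∑_{p<x} Kl(1,p)| ≤ ε π(x)`; and
  `DrappeauMaynard2019.signChanges_of_smallEtaCharacters` — `SmallEtaCharacters c` (the absolute `c`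
  of Corollary 1.3) ⇒ sign changes of `Kl(1, n)`, `ω(n) = 2`, beyond every bound.

Index only: Theorem 1.2 (the smoothly weighted sum `S(x)` over `pq` with `φ ∈ C_c^∞(ℝ₊^*)`:
`|S(x)| ≪_φ x log²x (ε + B L(1,χ) log x)`; not typed — smooth compactly supported weights).

LABEL: instrument / statement layer. WHAT THIS IS NOT: no claim that exceptional characters exist;
nothing here bears on the horizontal Sato–Tate conjecture unconditionally.

## References

* [DrappeauMaynard2018] S. Drappeau, J. Maynard, *Sign changes of Kloosterman sums and exceptional
  characters*, Proc. Amer. Math. Soc. 147 (2019), no. 1, 61–75, doi:10.1090/proc/14239 =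
  arXiv:1802.10278: §1 Theorems 1.1–1.2, Corollary 1.3.
* [FriedlanderIwaniec2019TwinPrimes] J. Friedlander, H. Iwaniec, Banach Center Publ. 118 (2019),
  (1.6) (the quantity `η(D)`; tree `SmallEtaCharacters`).
-/

noncomputable section

open Finset

namespace Literature.NumberTheory.LFunctions

namespace DrappeauMaynard2019

/-- **The normalised Kloosterman sum `Kl(1, n) = n^{−1/2} ∑_{ν mod n, (ν,n)=1} e((ν + ν̄)/n)`**
(`= S(1, 1; n)/√n` on the tree's `kloostermanSum`; `0` at `n = 0` by convention).
[cite: DrappeauMaynard2018, §1 (first display)] -/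
def kl (n : ℕ) : ℂ :=
  if h : n = 0 then 0 else
    haveI : NeZero n := ⟨h⟩
    kloostermanSum n 1 1 / (Real.sqrt n : ℂ)

end DrappeauMaynard2019

/-- **Drappeau–Maynard 2019, Theorem 1.1 (NAMED FACT, as printed).** «Let `ε > 0`. Then there are
constants `A, B > 0`, depending only on `ε`, such that for `D ≥ 3`, `x ≥ D^A` and any primitive real
character `χ mod D`, we have `|∑_{p<x} Kl(1, p)| ≤ π(x)(ε + B L(1, χ) log x)`.» (Unconditional;
«only non-trivial if the value `η_χ` is suitably small».) Rendered with natural `x`,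
`∑_{p < x}` over `Nat.primesBelow x`, `π(x) = Nat.primeCounting x` and `L(1,χ)` as `‖L(1,χ)‖`. Not
proved here (Bombieri's sieve with the exceptional character, twisted sums of Kloosterman sums).
[cite: DrappeauMaynard2018, §1 Theorem 1.1] -/
def drappeauMaynard2019_theorem11 : Prop :=
  ∀ ε : ℝ, 0 < ε → ∃ A B : ℝ, 0 < A ∧ 0 < B ∧
    ∀ (D : ℕ) [NeZero D] (χ : DirichletCharacter ℂ D), 3 ≤ D → χ.IsPrimitive → χ.IsQuadratic →
      ∀ x : ℕ, (D : ℝ) ^ A ≤ x →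
        ‖∑ p ∈ Nat.primesBelow x, DrappeauMaynard2019.kl p‖ ≤
          Nat.primeCounting x * (ε + B * ‖χ.LFunction 1‖ * Real.log x)

/-- **Drappeau–Maynard 2019, Corollary 1.3 (NAMED FACT, as printed).** «For some absolute constants
`A, c > 0`, if `η_χ ≤ c`, then every interval `[x, 2x] ⊂ [D^A, D^{100A}]` contains two numbers
`(n₁, n₂)` with `ω(n₁) = ω(n₂) = 2`, and `Kl(1, n₁) Kl(1, n₂) < 0`» (`η_χ = L(1,χ) log D`, `χ` real
primitive mod `D ≥ 3`; `Kl(1, n)` is real — rendered on real parts; `x` natural). Not proved here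
(from Theorem 1.2 and Fouvry–Kowalski–Michel's lower bound for `∑ |Kl(1, pq)|`).
[cite: DrappeauMaynard2018, §1 Corollary 1.3] -/
def drappeauMaynard2019_corollary13 : Prop :=
  ∃ A c : ℝ, 0 < A ∧ 0 < c ∧
    ∀ (D : ℕ) [NeZero D] (χ : DirichletCharacter ℂ D), 3 ≤ D → χ.IsPrimitive → χ.IsQuadratic →
      ‖χ.LFunction 1‖ * Real.log D ≤ c →
      ∀ x : ℕ, (D : ℝ) ^ A ≤ x → (2 * x : ℝ) ≤ (D : ℝ) ^ (100 * A) →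
        ∃ n₁ n₂ : ℕ, x ≤ n₁ ∧ n₁ ≤ 2 * x ∧ x ≤ n₂ ∧ n₂ ≤ 2 * x ∧
          n₁.primeFactors.card = 2 ∧ n₂.primeFactors.card = 2 ∧
          (DrappeauMaynard2019.kl n₁).re * (DrappeauMaynard2019.kl n₂).re < 0

namespace DrappeauMaynard2019

/-! ### PROVED readings on the column's hypothesis `SmallEtaCharacters` -/

/-- For `D ≥ 3`, `1 < log D`. [folklore] -/
private theorem one_lt_log_of_three_le {D : ℕ} (hD : 3 ≤ D) : 1 < Real.log D := by
  have hD3 : (3 : ℝ) ≤ (D : ℝ) := by exact_mod_cast hD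
  have hlog3 : 1 < Real.log 3 := by
    have h := Real.exp_one_lt_d9
    rw [Real.lt_log_iff_exp_lt (by norm_num)]
    linarith
  exact lt_of_lt_of_le hlog3 (Real.log_le_log (by norm_num) hD3)

/-- **Horizontal Sato–Tate cancellation along a subsequence** («if there is a sequence of characters
with `η_{χ_i} → 0`, then Theorem 1.1 shows that for a suitable sequence of values of `x`,
`∑_{p<x} Kl(1,p) = o(π(x))`»), PROVED modulo Theorem 1.1 with the hypothesis in the column's form
`∀ ε > 0, SmallEtaCharacters ε`: for every `ε > 0` there are arbitrarily large `x` with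
`|∑_{p<x} Kl(1, p)| ≤ ε π(x)`. (At `x = ⌈D^A⌉`: `L(1,χ) log x ≤ (A + 1) η_χ`, so a character with
`η_χ ≤ ε/(2B(A+1))` gives `ε/2 + B(A+1)η_χ ≤ ε`.) [cite: DrappeauMaynard2018, §1, remark after Theorem 1.1] -/
theorem horizontalSatoTate_frequently (h : drappeauMaynard2019_theorem11)
    (hη : ∀ ε : ℝ, 0 < ε → SmallEtaCharacters ε) {ε : ℝ} (hε : 0 < ε) (N : ℕ) :
    ∃ x : ℕ, N ≤ x ∧
      ‖∑ p ∈ Nat.primesBelow x, kl p‖ ≤ ε * Nat.primeCounting x := by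
  obtain ⟨A, B, hA, hB, hmain⟩ := h (ε / 2) (half_pos hε)
  -- a character with `η_χ ≤ ε/(2B(A+1))` at a conductor with `D^A ≥ N`
  have hAB : 0 < 2 * B * (A + 1) := by positivity
  set ε' : ℝ := ε / (2 * B * (A + 1)) with hε'
  have hε'0 : 0 < ε' := div_pos hε hAB
  obtain ⟨D, hDne, χ, hDq, hD3, hprim, hquad, hηχ⟩ :=
    hη ε' hε'0 (⌈(N : ℝ) ^ (1 / A)⌉₊ + 3)
  haveI := hDne
  have hD3' : (3 : ℝ) ≤ D := by exact_mod_cast hD3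
  have hDpos : (0 : ℝ) < D := by linarith
  have hlogD : 1 < Real.log D := one_lt_log_of_three_le hD3
  -- `x = ⌈D^A⌉`
  set x : ℕ := ⌈(D : ℝ) ^ A⌉₊ with hxdef
  have hDA1 : (1 : ℝ) ≤ (D : ℝ) ^ A := Real.one_le_rpow (by linarith) hA.le
  have hxlo : (D : ℝ) ^ A ≤ x := Nat.le_ceil _
  have hxhi : (x : ℝ) ≤ (D : ℝ) ^ A + 1 := by
    rw [hxdef]; exact (Nat.ceil_lt_add_one (by positivity)).le
  have hx1 : (1 : ℝ) ≤ x := hDA1.trans hxlo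
  have hxpos : (0 : ℝ) < x := by linarith
  refine ⟨x, ?_, ?_⟩
  · -- `N ≤ D^A ≤ x`: `D ≥ N^{1/A}`
    have hND : (N : ℝ) ^ (1 / A) ≤ D := by
      have h1 : (N : ℝ) ^ (1 / A) ≤ (⌈(N : ℝ) ^ (1 / A)⌉₊ : ℝ) := Nat.le_ceil _
      have h2 : ((⌈(N : ℝ) ^ (1 / A)⌉₊ + 3 : ℕ) : ℝ) ≤ D := by exact_mod_cast hDq
      push_cast at h2
      linarith
    have hN : (N : ℝ) ≤ (D : ℝ) ^ A := by
      have h0 : (0 : ℝ) ≤ (N : ℝ) ^ (1 / A) := by positivity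
      calc (N : ℝ) = ((N : ℝ) ^ (1 / A)) ^ A := by
            rw [← Real.rpow_mul (by positivity), one_div_mul_cancel hA.ne', Real.rpow_one]
        _ ≤ (D : ℝ) ^ A := Real.rpow_le_rpow h0 hND hA.le
    exact_mod_cast hN.trans hxlo
  · have hb := hmain D χ hD3 hprim hquad x hxlo
    refine hb.trans ?_
    have hπ : (0 : ℝ) ≤ Nat.primeCounting x := by positivity
    -- `log x ≤ log(D^A + 1) ≤ log(2 D^A) = log 2 + A log D ≤ (A + 1) log D`
    have hlogx : Real.log x ≤ (A + 1) * Real.log D := by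
      have h1 : Real.log x ≤ Real.log (2 * (D : ℝ) ^ A) :=
        Real.log_le_log hxpos (by linarith)
      have h2 : Real.log (2 * (D : ℝ) ^ A) = Real.log 2 + A * Real.log D := by
        rw [Real.log_mul (by norm_num) (by positivity), Real.log_rpow hDpos]
      have h3 : Real.log 2 ≤ Real.log D := Real.log_le_log (by norm_num) (by linarith)
      rw [h2] at h1
      nlinarith
    have hL0 : 0 ≤ ‖χ.LFunction 1‖ := norm_nonneg _
    -- `B L log x ≤ B (A+1) η ≤ ε/2`
    have hkey : B * ‖χ.LFunction 1‖ * Real.log x ≤ ε / 2 := by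
      calc B * ‖χ.LFunction 1‖ * Real.log x ≤ B * ‖χ.LFunction 1‖ * ((A + 1) * Real.log D) := by
            gcongr
        _ = B * (A + 1) * (‖χ.LFunction 1‖ * Real.log D) := by ring
        _ ≤ B * (A + 1) * ε' := by gcongr
        _ = ε / 2 := by rw [hε']; field_simp
    calc (Nat.primeCounting x : ℝ) * (ε / 2 + B * ‖χ.LFunction 1‖ * Real.log x)
        ≤ (Nat.primeCounting x : ℝ) * (ε / 2 + ε / 2) := by gcongr
      _ = ε * Nat.primeCounting x := by ring

/-- **Sign changes of `Kl(1, n)`, `ω(n) = 2`, beyond every bound** — PROVED modulo Corollary 1.3 under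
`SmallEtaCharacters c` (`c` the corollary's absolute constant; a fortiori under
`∀ ε > 0, SmallEtaCharacters ε`): «in the presence of Siegel zeros, we are able to establish
infinitely many sign changes of `Kl(1, pq)`». [cite: DrappeauMaynard2018, §1 Corollary 1.3 and the sentence before it] -/
theorem signChanges_of_smallEtaCharacters (h : drappeauMaynard2019_corollary13) :
    ∃ c : ℝ, 0 < c ∧ (SmallEtaCharacters c → ∀ N : ℕ, ∃ n₁ n₂ : ℕ, N ≤ n₁ ∧ N ≤ n₂ ∧
      n₁.primeFactors.card = 2 ∧ n₂.primeFactors.card = 2 ∧ (kl n₁).re * (kl n₂).re < 0) := by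
  obtain ⟨A, c, hA, hc, hmain⟩ := h
  refine ⟨c, hc, fun hη N => ?_⟩
  have h99A : 0 < 99 * A := by positivity
  -- a character with `η_χ ≤ c` at a conductor `D` with `D^A ≥ N` and `D^{99A} ≥ 4`
  obtain ⟨D, hDne, χ, hDq, hD3, hprim, hquad, hηχ⟩ :=
    hη (⌈(N : ℝ) ^ (1 / A)⌉₊ + ⌈(4 : ℝ) ^ (1 / (99 * A))⌉₊ + 3)
  haveI := hDne
  have hD3' : (3 : ℝ) ≤ D := by exact_mod_cast hD3
  have hDpos : (0 : ℝ) < D := by linarith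
  have hDq' : (⌈(N : ℝ) ^ (1 / A)⌉₊ : ℝ) + (⌈(4 : ℝ) ^ (1 / (99 * A))⌉₊ : ℝ) + 3 ≤ (D : ℝ) := by
    exact_mod_cast hDq
  have hc1 : (N : ℝ) ^ (1 / A) ≤ (⌈(N : ℝ) ^ (1 / A)⌉₊ : ℝ) := Nat.le_ceil _
  have hc2 : (4 : ℝ) ^ (1 / (99 * A)) ≤ (⌈(4 : ℝ) ^ (1 / (99 * A))⌉₊ : ℝ) := Nat.le_ceil _
  have hc1' : (0 : ℝ) ≤ (⌈(N : ℝ) ^ (1 / A)⌉₊ : ℝ) := Nat.cast_nonneg _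
  have hc2' : (0 : ℝ) ≤ (⌈(4 : ℝ) ^ (1 / (99 * A))⌉₊ : ℝ) := Nat.cast_nonneg _
  have hND : (N : ℝ) ^ (1 / A) ≤ D := by linarith
  have h4D : (4 : ℝ) ^ (1 / (99 * A)) ≤ D := by linarith
  -- `x = ⌈D^A⌉`: `D^A ≤ x ≤ D^A + 1`, `N ≤ D^A`, `2x ≤ 4 D^A ≤ D^{100A}`
  set x : ℕ := ⌈(D : ℝ) ^ A⌉₊ with hxdef
  have hDA1 : (1 : ℝ) ≤ (D : ℝ) ^ A := Real.one_le_rpow (by linarith) hA.le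
  have hxlo : (D : ℝ) ^ A ≤ x := Nat.le_ceil _
  have hxhi : (x : ℝ) ≤ (D : ℝ) ^ A + 1 := (Nat.ceil_lt_add_one (by positivity)).le
  have hN : (N : ℝ) ≤ (D : ℝ) ^ A := by
    calc (N : ℝ) = ((N : ℝ) ^ (1 / A)) ^ A := by
          rw [← Real.rpow_mul (by positivity), one_div_mul_cancel hA.ne', Real.rpow_one]
      _ ≤ (D : ℝ) ^ A := Real.rpow_le_rpow (by positivity) hND hA.le
  have h4 : (4 : ℝ) ≤ (D : ℝ) ^ (99 * A) := by
    calc (4 : ℝ) = ((4 : ℝ) ^ (1 / (99 * A))) ^ (99 * A) := by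
          rw [← Real.rpow_mul (by norm_num), one_div_mul_cancel h99A.ne', Real.rpow_one]
      _ ≤ (D : ℝ) ^ (99 * A) := Real.rpow_le_rpow (by positivity) h4D h99A.le
  have h2x : (2 * x : ℝ) ≤ (D : ℝ) ^ (100 * A) := by
    have h1 : (D : ℝ) ^ (100 * A) = (D : ℝ) ^ A * (D : ℝ) ^ (99 * A) := by
      rw [← Real.rpow_add hDpos]; ring_nf
    rw [h1]
    nlinarith
  obtain ⟨n₁, n₂, h1lo, -, h2lo, -, hω1, hω2, hsign⟩ := hmain D χ hD3 hprim hquad hηχ x hxlo h2x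
  have hNx : N ≤ x := by exact_mod_cast hN.trans hxlo
  exact ⟨n₁, n₂, hNx.trans h1lo, hNx.trans h2lo, hω1, hω2, hsign⟩

end DrappeauMaynard2019

end Literature.NumberTheory.LFunctions

end
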